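import Summits.QuantumFields.YangMills.Theorems.UnitScaleTiltProp7ProjRTopMeanCover
import Summits.QuantumFields.YangMills.Theorems.UnitScaleTiltCoverKernelFibreSum
import HarnessLib

/-!
# Route `UnitScaleTilt`, crux K1 «MinimiserStabilityRegPr» (stmt-QuantumFields-19200), EX row `h349` — SMALL MEMBERS VIA THE COVER, ROW (c2″):
# **THE `h349`-KERNEL ROW DESCENDS ALONG THE `L^{jc}`-FOLD COVER (METHOD OF IMAGES)** — the kernel entry of print's `D_W(1 − R_{Q″}(W))D*_W` between two bond
# spikes of a member is the FIBRE SUM of the cover member's kernel entries, so an exponentially decaying kernel row on the cover descends with the SAME rate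
# and the constant multiplied by the degree `(L^{jc})³`

Cell `ym3-torus` (HUMAN RULING D-0037: YM₃ on T³ is ladder rung R3 — NOT d = 4, NOT infinite volume, NOT a mass gap, NOT Clay).  Width seat `ym3-torus-px12` (gen 16);
px10 g12's LOCATE-K349-IDX-KNIT (19200 evidence #53) §2 (Q-ROOM) option (α).  THEOREMS ONLY (0 `def`, 0 `sorry`, default heartbeats); `--supports stmt-QuantumFields-19200 --as helper`;
count-neutral.

WHY.  The (L3′b) storey inhabits the `h349` door ✓`Prop7KernelRow349DoorOfLODTarget.kernelRow349_idx_of_projRTarget` through the member-level kernel row of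
`A_W := D_W(1 − projR Δ_W Q″)D*_W` (V6 ✓`Prop7ComplementaryProjectorGradientKernel` ∘ (G1-3b)(ii) ✓`Prop7CurvedMemberGradientRow`), whose gradient knit carries the
no-wrap room `2(12·L^{K−n} + 5) ≤ sitesPerDir 0`, false on the small members (`L^{F.m+n} < 13`) — the same class ★p1 g25 CHAIR WORD №1 met for the `hT` row by the
COVER ROAD ((c1) ✓p759421, (c2) ✓`Prop7ProjRTopMeanCover`, (c3) ✓`Prop7CoverTargetTransfer`).  For `h349` the transfer is a POINTWISE-KERNEL one: with `π` the covering map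
of ✓`CoverSites` and `Ã` the same operator at the cover member `(F.cover jc, W∘π, Q″_c)`, the three naturality rows ✓`Prop7CoverHilbertPullback.DstarL2_cover'` (3.8),
✓`Prop7ProjRTopMeanCover.projR_topMean_cover` (3.21) and ✓`DL2_cover'` (3.3) give `Ã(X∘π) = (A_W X)∘π`; a bond spike pulls back to the fibre sum of spikes
(✓`CoverKernelFibreSum.single_comp_projBond`), so `(A_W δ_b Z)(bd) = Σ_{π b̃ = b} (Ã δ_{b̃} Z)(b̃d)` for any lift `b̃d` of `bd` — the method of images for the lifted
periodic operator; and since `π` commutes with the iterated blocks (✓`CoverSites.proj_iterBlockOf`) and shrinks the `ℓ¹` torus distance (✓`CoverKernelFibreSum.tdist_proj_le`),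
every image term obeys the downstairs decay factor, the fibre having `(L^{jc})³` elements (✓`CoverSites.card_fibre_bond`).  Print: the constants of [Balaban1985BackgroundPropagators]
Thm 3.1–3.3 «do not depend on the sequence {Ω_j}» (p.399 L1–3), read on the cover (3.49) p.399.

WHAT IS PROVED (ns `…Theorems.Prop7KernelRow349OfCover`; `Q₀` any averaging-of-record map at `W`, `Q₁` any at `W ∘ projBond (F.P K) jc 0` — the `hseq` clauses (iii) of
✓`Prop7NSIntertwinerOfRecord.exists_intertwiner_of_regPr` at `F` and at `F.cover jc`, VERBATIM as in ✓`Prop7ProjRTopMeanCover`).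
* §1 ★★ `kernel349_comp_projBond` — NATURALITY: `Ã (X ∘ π) = (A_W X) ∘ π` for every bond field `X` downstairs.
* §2 ★★★ `kernel349_single_apply_eq_fibre_sum` — METHOD OF IMAGES: `(A_W (δ_b ⊗ Z))(π b̃d) = Σ_{π b̃ = b} (Ã (δ_{b̃} ⊗ Z))(b̃d)`.
* §3 `norm_sum_le_card_mul` (a finite sum of terms bounded by one constant) · ★★★ `kernelRow349_of_cover` — THE DESCENT: if
  `‖(Ã (δ_{b̃} ⊗ Z))(b̃d)‖ ≤ C·e^{−δ·tdist(B b̃.src, B b̃d.src)}·‖Z‖` for all cover bonds `b̃ b̃d` then `‖(A_W (δ_b ⊗ Z))(bd)‖ ≤ ((L^{jc})³·C)·e^{−δ·tdist(B b.src, B bd.src)}·‖Z‖`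
  for all member bonds `b bd` (`B = iterBlockOf (K − n)`, `δ ≥ 0`; SAME rate) · ★★ `kernelRow349_of_cover_hK` — the same in the integrand shape of the door's `hK` binder
  (constant `C·((L:ℝ)^(K−n))⁻¹^3`, i.e. `C ↦ (L^{jc})³·C`).
* §4 `room_cover` — for `jc ≥ 3` the cover member HAS the gradient knit's no-wrap room `2·(12·L^{K−n} + 5) ≤ sitesPerDir 0`, whatever the member.
HYP-SAT (★★OWNER RULING №42).  §1–§2 are identities with no hypothesis beyond the `Q″`-of-record clauses (inhabited by ✓`exists_intertwiner_of_regPr` at both members);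
§3's displayed hypothesis is the cover member's kernel row — a real-inequality schema, inhabited (K-free) by V6 ∘ (ii-c) ∘ the namer's pin at the cover member, where the
no-wrap room holds for `jc := 3` (`(F.cover jc).m = F.m + jc`); the conclusion is the member's row, non-vacuous; no `Prop` hypothesis restates it.
HONEST SCOPE.  Identities + one finite sum; nothing of `hK349`, `h349`, the ten EX rows, `hT`, EX `stub_existenceMinimalOrbit` or the crux is proved here; the Yang–Mills
mass gap is NOT proved.

References: T. Bałaban, CMP **99** (1985) 389–434 [Balaban1985BackgroundPropagators] ((3.3) p.390, (3.8) p.392, (3.21) p.394, (3.49) p.399, p.399 L1–3);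
CMP **109** (1987) 249–301 [Balaban1987RG1] ((0.1)–(0.3) pp.251–252); CMP **95** (1984) 17–40 [Balaban1984PropagatorsI] ((1.109)–(1.110) p.35).
-/

set_option autoImplicit false

noncomputable section

open scoped BigOperators Matrix.Norms.L2Operator InnerProductSpace

namespace Summit.QuantumFields.YangMills.Theorems.Prop7KernelRow349OfCover

open Literature.MathematicalPhysics.QuantumFieldTheory.Balaban1983to89
open Literature.MathematicalPhysics.QuantumFieldTheory.Balaban1983to89.T3ContinuumYM3Torus
open T4Continuum BlockAveraging
open BlockAveraging (Idx)
open B7Prop1Explicit (disp)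
open B10Eq27TorusAxialLog (holT transl)
open B7TransferAnalyticMean (meanCLM)
open B11Eq103H1Complex (SiteL2K projR)
open B5Eq118OneStroke (iterBlockOf)
open T3SectALandauChart (bgUnits)
open Summit.QuantumFields.YangMills.Theorems.Prop8Chart (emlIterU)
open Summit.QuantumFields.YangMills.Theorems.Prop7SectET3Transport (periodsT3)
open Summit.QuantumFields.YangMills.Theorems.Prop7SectET3HilbertLetters (W₂ toL2 toL2S DL2 DstarL2 covLapSite)
open Summit.QuantumFields.YangMills.Theorems.CoverSites
open Summit.QuantumFields.YangMills.Theorems.CoverKernelFibreSum (single_comp_projBond tdist_proj_le)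
open Summit.QuantumFields.YangMills.Theorems.Prop7CoverHilbertPullback (DL2_cover' DstarL2_cover')
open Summit.QuantumFields.YangMills.Theorems.Prop7ProjRTopMeanCover (projR_topMean_cover)

variable (F : T3Family) (jc : ℕ) {n K : ℕ} (hnK : n ≤ K) (c₀ : ℝ) [Fact (0 < c₀)] (W : GaugeField (F.P K) 0 (Matrix.specialUnitaryGroup (Fin 2) ℂ))
  (Q₀ : SiteL2K ℂ 3 (periodsT3 F K) c₀ W₂ →ₗ[ℂ] (Site (F.P K) (K - n) → Matrix (Fin 2) (Fin 2) ℂ))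
  (hseq₀ : ∀ lam : Site (F.P K) 0 → Matrix (Fin 2) (Fin 2) ℂ, ∃ ns : (j : ℕ) → Site (F.P K) j → Matrix (Fin 2) (Fin 2) ℂ, ns 0 = lam ∧
    (∀ (j : ℕ) (y : Site (F.P K) (j + 1)), ns (j + 1) y = ns j (emb y) - meanCLM (Idx (F.P K)) (Matrix (Fin 2) (Fin 2) ℂ) fun i : Idx (F.P K) =>
      ns j (emb y) - ((holT (emlIterU j (bgUnits F K W)) (emb y) (stairWord i.2.1 (off i.1)) : (Matrix (Fin 2) (Fin 2) ℂ)ˣ) : Matrix (Fin 2) (Fin 2) ℂ) *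
        ns j (transl (emb y) (disp (stairWord i.2.1 (off i.1)))) * (((holT (emlIterU j (bgUnits F K W)) (emb y) (stairWord i.2.1 (off i.1)))⁻¹ : (Matrix (Fin 2) (Fin 2) ℂ)ˣ) : Matrix (Fin 2) (Fin 2) ℂ)) ∧
    ns (K - n) = Q₀ (toL2S F K c₀ lam))
  (Q₁ : SiteL2K ℂ 3 (periodsT3 (F.cover jc) K) c₀ W₂ →ₗ[ℂ] (Site ((F.cover jc).P K) (K - n) → Matrix (Fin 2) (Fin 2) ℂ))
  (hseq₁ : ∀ lam : Site ((F.cover jc).P K) 0 → Matrix (Fin 2) (Fin 2) ℂ, ∃ ns : (j : ℕ) → Site ((F.cover jc).P K) j → Matrix (Fin 2) (Fin 2) ℂ, ns 0 = lam ∧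
    (∀ (j : ℕ) (y : Site ((F.cover jc).P K) (j + 1)), ns (j + 1) y = ns j (emb y) - meanCLM (Idx ((F.cover jc).P K)) (Matrix (Fin 2) (Fin 2) ℂ) fun i : Idx ((F.cover jc).P K) =>
      ns j (emb y) - ((holT (emlIterU j (bgUnits (F.cover jc) K (W ∘ projBond (F.P K) jc 0))) (emb y) (stairWord i.2.1 (off i.1)) : (Matrix (Fin 2) (Fin 2) ℂ)ˣ) : Matrix (Fin 2) (Fin 2) ℂ) *
        ns j (transl (emb y) (disp (stairWord i.2.1 (off i.1)))) *
          (((holT (emlIterU j (bgUnits (F.cover jc) K (W ∘ projBond (F.P K) jc 0))) (emb y) (stairWord i.2.1 (off i.1)))⁻¹ : (Matrix (Fin 2) (Fin 2) ℂ)ˣ) : Matrix (Fin 2) (Fin 2) ℂ)) ∧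
    ns (K - n) = Q₁ (toL2S (F.cover jc) K c₀ lam))

include hnK hseq₀ hseq₁

/-! ## §1 Naturality of `A_W = D_W(1 − R_{Q″}(W))D*_W` under the pullback -/

/-- ★★ **`Ã (X ∘ π) = (A_W X) ∘ π`** — print's `D_W(1 − R_{Q″}(W))D*_W` ((3.49) p.399) at the cover member `(F.cover jc, W∘π)` with the `Q″` of record there, applied to a
lifted bond field, is the lift of the member's; from the three local∕natural rows (3.8) ✓`DstarL2_cover'`, (3.21) ✓`projR_topMean_cover`, (3.3) ✓`DL2_cover'`.
[cite: Balaban1985BackgroundPropagators, (3.3) p.390, (3.8) p.392, (3.21) p.394, (3.49) p.399] -/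
theorem kernel349_comp_projBond (X : PBond (F.P K) 0 → Matrix (Fin 2) (Fin 2) ℂ) :
    (toL2 (F.cover jc) K c₀).symm
        (DL2 (F.cover jc) n K c₀ (W ∘ projBond (F.P K) jc 0)
          (DstarL2 (F.cover jc) n K c₀ (W ∘ projBond (F.P K) jc 0) (toL2 (F.cover jc) K c₀ (X ∘ projBond (F.P K) jc 0))
            - projR (covLapSite (F.cover jc) n K c₀ (W ∘ projBond (F.P K) jc 0)) Q₁
                (DstarL2 (F.cover jc) n K c₀ (W ∘ projBond (F.P K) jc 0) (toL2 (F.cover jc) K c₀ (X ∘ projBond (F.P K) jc 0)))))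
      = ((toL2 F K c₀).symm
          (DL2 F n K c₀ W (DstarL2 F n K c₀ W (toL2 F K c₀ X) - projR (covLapSite F n K c₀ W) Q₀ (DstarL2 F n K c₀ W (toL2 F K c₀ X)))))
        ∘ projBond (F.P K) jc 0 := by
  -- (3.8): the divergence of the lifted field is the lift of the divergence
  have hDs := DstarL2_cover' F jc n K c₀ W X
  -- (3.21): the gauge projector of record commutes with the pullback
  have hR := projR_topMean_cover F jc hnK c₀ W Q₀ hseq₀ Q₁ hseq₁ ((toL2S F K c₀).symm (DstarL2 F n K c₀ W (toL2 F K c₀ X)))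
  rw [LinearEquiv.apply_symm_apply] at hR
  -- the difference is again a lift
  have hsub : toL2S (F.cover jc) K c₀ (((toL2S F K c₀).symm (DstarL2 F n K c₀ W (toL2 F K c₀ X))) ∘ proj (F.P K) jc 0)
      - toL2S (F.cover jc) K c₀ (((toL2S F K c₀).symm (projR (covLapSite F n K c₀ W) Q₀ (DstarL2 F n K c₀ W (toL2 F K c₀ X)))) ∘ proj (F.P K) jc 0)
      = toL2S (F.cover jc) K c₀ (((toL2S F K c₀).symm (DstarL2 F n K c₀ W (toL2 F K c₀ X) - projR (covLapSite F n K c₀ W) Q₀ (DstarL2 F n K c₀ W (toL2 F K c₀ X)))) ∘ proj (F.P K) jc 0) := by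
    rw [← map_sub, map_sub]
    rfl
  rw [hDs, hR, hsub, DL2_cover' F jc n K c₀ W, LinearEquiv.apply_symm_apply, LinearEquiv.symm_apply_apply]
  rfl

/-! ## §2 The method of images -/

/-- ★★★ **METHOD OF IMAGES FOR `D_W(1 − R_{Q″}(W))D*_W`**: the member's kernel entry between the bond spikes at `b` and `bd` equals the SUM over the lifts `b̃` of `b`
of the cover member's kernel entries between `b̃` and any fixed lift `b̃d` of `bd` (§1 + the pullback of a point source is the fibre sum of point sources,
✓`CoverKernelFibreSum.single_comp_projBond`, + linearity). [cite: Balaban1985BackgroundPropagators, (3.49) p.399, p.399 L1–3; Balaban1987RG1, (0.1)–(0.2) pp.251–252] -/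
theorem kernel349_single_apply_eq_fibre_sum (b : PBond (F.P K) 0) (Z : Matrix (Fin 2) (Fin 2) ℂ) (bdt : PBond ((F.cover jc).P K) 0) :
    (toL2 F K c₀).symm
        (DL2 F n K c₀ W (DstarL2 F n K c₀ W (toL2 F K c₀ (Pi.single b Z)) - projR (covLapSite F n K c₀ W) Q₀ (DstarL2 F n K c₀ W (toL2 F K c₀ (Pi.single b Z)))))
        (projBond (F.P K) jc 0 bdt)
      = ∑ bt ∈ Finset.univ.filter (fun bt : PBond ((F.cover jc).P K) 0 => projBond (F.P K) jc 0 bt = b),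
          (toL2 (F.cover jc) K c₀).symm
            (DL2 (F.cover jc) n K c₀ (W ∘ projBond (F.P K) jc 0)
              (DstarL2 (F.cover jc) n K c₀ (W ∘ projBond (F.P K) jc 0) (toL2 (F.cover jc) K c₀ (Pi.single bt Z))
                - projR (covLapSite (F.cover jc) n K c₀ (W ∘ projBond (F.P K) jc 0)) Q₁
                    (DstarL2 (F.cover jc) n K c₀ (W ∘ projBond (F.P K) jc 0) (toL2 (F.cover jc) K c₀ (Pi.single bt Z))))) bdt := by
  classical
  have hnat := congrFun (kernel349_comp_projBond F jc hnK c₀ W Q₀ hseq₀ Q₁ hseq₁ (Pi.single b Z)) bdt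
  rw [Function.comp_apply] at hnat
  -- the pullback of the bond spike is the fibre sum of bond spikes (stated at the cover MEMBER's bond type)
  have hsingle : ((Pi.single b Z : PBond (F.P K) 0 → Matrix (Fin 2) (Fin 2) ℂ) ∘ projBond (F.P K) jc 0 :
        PBond ((F.cover jc).P K) 0 → Matrix (Fin 2) (Fin 2) ℂ)
      = ∑ bt ∈ Finset.univ.filter (fun bt : PBond ((F.cover jc).P K) 0 => projBond (F.P K) jc 0 bt = b),
          (Pi.single bt Z : PBond ((F.cover jc).P K) 0 → Matrix (Fin 2) (Fin 2) ℂ) := by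
    exact single_comp_projBond (F.P K) jc b Z
  rw [← hnat, hsingle]
  simp only [map_sum, ← Finset.sum_sub_distrib, Finset.sum_apply]

/-! ## §3 The descent of an exponentially decaying kernel row -/

omit hnK hseq₀ hseq₁ in
/-- A finite sum whose terms are bounded in norm by one constant is bounded by the cardinality times the constant. [folklore] -/
theorem norm_sum_le_card_mul {ι E : Type*} [SeminormedAddCommGroup E] (s : Finset ι) (f : ι → E) {c : ℝ}
    (h : ∀ i ∈ s, ‖f i‖ ≤ c) : ‖∑ i ∈ s, f i‖ ≤ s.card * c :=
  (norm_sum_le s f).trans (by simpa using Finset.sum_le_card_nsmul s (fun i => ‖f i‖) c h)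

/-- ★★★ **THE `h349`-KERNEL ROW DESCENDS ALONG THE COVER** (method of images + the degree): if the cover member's kernel of `D(1 − R_{Q″_c})D*` at `W∘π` decays like
`C·e^{−δ·tdist(B b̃.src, B b̃d.src)}` between bond spikes (`B = iterBlockOf (K − n)`, `δ ≥ 0`), then the member's kernel at `W` decays like
`((L^{jc})³·C)·e^{−δ·tdist(B b.src, B bd.src)}` — SAME RATE: each of the `(L^{jc})³` images (✓`CoverSites.card_fibre_bond`) lies over `b`, the blocks commute with `π`
(✓`CoverSites.proj_iterBlockOf`) and `π` shrinks the `ℓ¹` torus distance (✓`CoverKernelFibreSum.tdist_proj_le`).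
[cite: Balaban1985BackgroundPropagators, Thm 3.1–3.3 pp.397–399, (3.49) p.399, p.399 L1–3; Balaban1987RG1, (0.2)–(0.3) p.252; Balaban1984PropagatorsI, (1.110) p.35] -/
theorem kernelRow349_of_cover {C δ : ℝ} (hC : 0 ≤ C) (hδ : 0 ≤ δ)
    (hK : ∀ (bt : PBond ((F.cover jc).P K) 0) (Z : Matrix (Fin 2) (Fin 2) ℂ) (bdt : PBond ((F.cover jc).P K) 0),
      ‖(toL2 (F.cover jc) K c₀).symm
          (DL2 (F.cover jc) n K c₀ (W ∘ projBond (F.P K) jc 0)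
            (DstarL2 (F.cover jc) n K c₀ (W ∘ projBond (F.P K) jc 0) (toL2 (F.cover jc) K c₀ (Pi.single bt Z))
              - projR (covLapSite (F.cover jc) n K c₀ (W ∘ projBond (F.P K) jc 0)) Q₁
                  (DstarL2 (F.cover jc) n K c₀ (W ∘ projBond (F.P K) jc 0) (toL2 (F.cover jc) K c₀ (Pi.single bt Z))))) bdt‖
        ≤ C * Real.exp (-(δ * (Site.tdist (iterBlockOf (K - n) bt.src) (iterBlockOf (K - n) bdt.src) : ℝ))) * ‖Z‖)
    (b : PBond (F.P K) 0) (Z : Matrix (Fin 2) (Fin 2) ℂ) (bd : PBond (F.P K) 0) :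
    ‖(toL2 F K c₀).symm
        (DL2 F n K c₀ W (DstarL2 F n K c₀ W (toL2 F K c₀ (Pi.single b Z)) - projR (covLapSite F n K c₀ W) Q₀ (DstarL2 F n K c₀ W (toL2 F K c₀ (Pi.single b Z))))) bd‖
      ≤ (((F.L : ℝ) ^ jc) ^ 3 * C) * Real.exp (-(δ * (Site.tdist (iterBlockOf (K - n) b.src) (iterBlockOf (K - n) bd.src) : ℝ))) * ‖Z‖ := by
  classical
  -- a lift of the target bond
  obtain ⟨bdt, hbdt⟩ := projBond_surjective (F.P K) jc 0 bd
  rw [← hbdt, kernel349_single_apply_eq_fibre_sum F jc hnK c₀ W Q₀ hseq₀ Q₁ hseq₁ b Z bdt]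
  have hlev : K - n ≤ (F.P K).m + (F.P K).K := by
    show K - n ≤ F.m + K
    omega
  -- every image term carries the downstairs decay factor
  have hterm : ∀ bt ∈ Finset.univ.filter (fun bt : PBond ((F.cover jc).P K) 0 => projBond (F.P K) jc 0 bt = b),
      ‖(toL2 (F.cover jc) K c₀).symm
          (DL2 (F.cover jc) n K c₀ (W ∘ projBond (F.P K) jc 0)
            (DstarL2 (F.cover jc) n K c₀ (W ∘ projBond (F.P K) jc 0) (toL2 (F.cover jc) K c₀ (Pi.single bt Z))
              - projR (covLapSite (F.cover jc) n K c₀ (W ∘ projBond (F.P K) jc 0)) Q₁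
                  (DstarL2 (F.cover jc) n K c₀ (W ∘ projBond (F.P K) jc 0) (toL2 (F.cover jc) K c₀ (Pi.single bt Z))))) bdt‖
        ≤ C * Real.exp (-(δ * (Site.tdist (iterBlockOf (K - n) b.src) (iterBlockOf (K - n) (projBond (F.P K) jc 0 bdt).src) : ℝ))) * ‖Z‖ := by
    intro bt hbt
    rw [Finset.mem_filter] at hbt
    refine (hK bt Z bdt).trans (mul_le_mul_of_nonneg_right (mul_le_mul_of_nonneg_left (Real.exp_le_exp.mpr ?_) hC) (norm_nonneg _))
    -- `tdist (B b.src) (B bd.src) ≤ tdist (B b̃.src) (B b̃d.src)`: blocks commute with `π`, which shrinks distances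
    have hd : Site.tdist (iterBlockOf (K - n) b.src) (iterBlockOf (K - n) (projBond (F.P K) jc 0 bdt).src)
        ≤ Site.tdist (iterBlockOf (K - n) bt.src) (iterBlockOf (K - n) bdt.src) := by
      rw [← hbt.2, projBond_src, projBond_src, ← proj_iterBlockOf (F.P K) jc (K - n) hlev, ← proj_iterBlockOf (F.P K) jc (K - n) hlev]
      exact tdist_proj_le (F.P K) jc _ _
    have hd' : (Site.tdist (iterBlockOf (K - n) b.src) (iterBlockOf (K - n) (projBond (F.P K) jc 0 bdt).src) : ℝ)
        ≤ (Site.tdist (iterBlockOf (K - n) bt.src) (iterBlockOf (K - n) bdt.src) : ℝ) := by exact_mod_cast hd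
    nlinarith
  -- the fibre has `(L^{jc})³` elements
  have hcard : (Finset.univ.filter (fun bt : PBond ((F.cover jc).P K) 0 => projBond (F.P K) jc 0 bt = b)).card = (F.L ^ jc) ^ 3 := by
    exact card_fibre_bond (F.P K) jc 0 (Nat.zero_le _) b
  refine (norm_sum_le_card_mul _ _ hterm).trans_eq ?_
  rw [hcard]
  push_cast
  ring

/-- ★★ **THE SAME IN THE DOOR's CURRENCY** — the integrand of ✓`Prop7KernelRow349DoorOfLODTarget.kernelRow349_of_projRTarget`'s `hK` binder (constant
`C·((L:ℝ)^(K−n))⁻¹^3·e^{−δ·tdist}`): the cover member's row at `(C, δ)` gives the member's row at `((L^{jc})³·C, δ)`. [cite: Balaban1985BackgroundPropagators, (3.49) p.399, p.399 L1–3] -/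
theorem kernelRow349_of_cover_hK {C δ : ℝ} (hC : 0 ≤ C) (hδ : 0 ≤ δ)
    (hK : ∀ (bt : PBond ((F.cover jc).P K) 0) (Z : Matrix (Fin 2) (Fin 2) ℂ) (bdt : PBond ((F.cover jc).P K) 0),
      ‖(toL2 (F.cover jc) K c₀).symm
          (DL2 (F.cover jc) n K c₀ (W ∘ projBond (F.P K) jc 0)
            (DstarL2 (F.cover jc) n K c₀ (W ∘ projBond (F.P K) jc 0) (toL2 (F.cover jc) K c₀ (Pi.single bt Z))
              - projR (covLapSite (F.cover jc) n K c₀ (W ∘ projBond (F.P K) jc 0)) Q₁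
                  (DstarL2 (F.cover jc) n K c₀ (W ∘ projBond (F.P K) jc 0) (toL2 (F.cover jc) K c₀ (Pi.single bt Z))))) bdt‖
        ≤ C * (((F.cover jc).L : ℝ) ^ (K - n))⁻¹ ^ 3
            * Real.exp (-(δ * (Site.tdist (iterBlockOf (K - n) bt.src) (iterBlockOf (K - n) bdt.src) : ℝ))) * ‖Z‖)
    (b : PBond (F.P K) 0) (Z : Matrix (Fin 2) (Fin 2) ℂ) (bd : PBond (F.P K) 0) :
    ‖(toL2 F K c₀).symm
        (DL2 F n K c₀ W (DstarL2 F n K c₀ W (toL2 F K c₀ (Pi.single b Z)) - projR (covLapSite F n K c₀ W) Q₀ (DstarL2 F n K c₀ W (toL2 F K c₀ (Pi.single b Z))))) bd‖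
      ≤ (((F.L : ℝ) ^ jc) ^ 3 * C) * ((F.L : ℝ) ^ (K - n))⁻¹ ^ 3
          * Real.exp (-(δ * (Site.tdist (iterBlockOf (K - n) b.src) (iterBlockOf (K - n) bd.src) : ℝ))) * ‖Z‖ := by
  have hℓ : 0 ≤ ((F.L : ℝ) ^ (K - n))⁻¹ ^ 3 := by positivity
  have h := kernelRow349_of_cover F jc hnK c₀ W Q₀ hseq₀ Q₁ hseq₁ (C := C * ((F.L : ℝ) ^ (K - n))⁻¹ ^ 3) (δ := δ) (mul_nonneg hC hℓ) hδ
    (fun bt Z bdt => by simpa only [T3Family.cover_L] using hK bt Z bdt) b Z bd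
  calc _ ≤ _ := h
    _ = _ := by ring

/-! ## §4 The no-wrap room holds on the cover -/

omit hseq₀ hseq₁ in
/-- **THE COVER HAS ROOM**: for `jc ≥ 3` the cover member `(F.cover jc, n, K)` satisfies the no-wrap antecedent `2·(12·L^{K−n} + 5) ≤ sitesPerDir 0` of the gradient knit
(✓`Prop7CurvedMemberGradientRowOfRegPr.column_gradient_decay_of_regPr`'s `hroom`) — WHATEVER the member: `sitesPerDir 0 = 2·L^{F.m+jc+K}` (✓`CoverSites.sitesPerDir_cover`) and
`L^{F.m+jc+n} ≥ 3⁴ = 81` (`L` odd `> 1`, `F.m ≥ 1`). [cite: Balaban1987RG1, (0.1)–(0.2) pp.251–252; Balaban1985Variational, (144) p.300] -/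
theorem room_cover (hjc : 3 ≤ jc) : 2 * (12 * (F.cover jc).L ^ (K - n) + 5) ≤ ((F.cover jc).P K).sitesPerDir 0 := by
  have hL3 : 3 ≤ F.L := by
    obtain ⟨⟨k, hk⟩, h1⟩ := F.hL
    omega
  have hm := F.hm
  show 2 * (12 * F.L ^ (K - n) + 5) ≤ 2 * F.L ^ (F.m + jc + K - 0)
  have hsplit : F.L ^ (F.m + jc + K - 0) = F.L ^ (F.m + jc + n) * F.L ^ (K - n) := by
    rw [← pow_add]
    congr 1
    omega
  have h81 : 81 ≤ F.L ^ (F.m + jc + n) :=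
    calc 81 = 3 ^ 4 := by norm_num
      _ ≤ F.L ^ 4 := Nat.pow_le_pow_left hL3 4
      _ ≤ F.L ^ (F.m + jc + n) := Nat.pow_le_pow_right (by omega) (by omega)
  have hx : 1 ≤ F.L ^ (K - n) := Nat.one_le_pow _ _ (by omega)
  rw [hsplit]
  nlinarith

end Summit.QuantumFields.YangMills.Theorems.Prop7KernelRow349OfCover

end
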